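import Summits.QuantumFields.YangMills.Theorems.AlphaInputsT3ACv3StepLowPrintOrbit
import Summits.QuantumFields.YangMills.Theorems.UnitScaleTiltProp7OrbitTransport
import Literature.MathematicalPhysics.QuantumFieldTheory.Balaban1983to89.T3Thm1Carrier
import HarnessLib

/-!
# `AlphaInputsT3ACv3StepLowPrintOrbitOfUniqueMin` — THE ORBIT-COVARIANCE LETTER `hcov` OF THE LOWER ROW AT PRINT'S FAMILY, DISCHARGED FROM ROW r1 AND
# [Balaban1985Variational] THM 1's UNIQUENESS CLAUSE AT THE RECORD'S CARRIERS (cell `ym3-torus`, (α)-row #23 `fibre57LowOn`, residue r1′ at print's constant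
# `c = 1`; seat `ym3-torus-px20` g14, width copy of p1; sequel of ✓`AlphaInputsT3ACv3StepLowPrintOrbit`; `--supports stmt-QuantumFields-19936 --as helper`)

WHAT.  ✓`AlphaInputsT3AC.PkgCoreRows.fibre57LowOnAC_T3_loPrintAC_of_le_gamma_of_orbit` (✓`…v3StepLowPrintOrbit` §2) displays the lower row of #23 at print's family
`loPrintAC 𝔠.lane q.X` ((47) p.267) with the level-`k` letter
`hcov : ∀ u V, |V(∂p) − 1| < ε₁(k) ∀p → ∃ w, U_k(V^u) = U_k(V)^w` («the record's minimiser `U_k = ukAll q.X.Uk k` is ORBIT-COVARIANT on the (4)-window»).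
For the record's SELECTED minimiser this is not among the rows r1–r3 (`MinimiserRowsT3`: existence in (8) + `IsMinOn` over (6)); it is, for ANY selection, a
consequence of the SECOND SENTENCE of [Balaban1985Variational] Thm 1 p.279 — «there exists a minimal orbit in the space 𝔘_k({Ω_j}, B₃ε₁) ∩ 𝔅_k(V) (8).
This orbit is a unique critical orbit in the space (6) if B₃ε₁ ≤ ε₀ and ε₀ ≤ a₀» — which the tree already states AS PRINTED over an abstract carrier
(`B11Thm1.Unique6`, the uniqueness conjunct of `B11Thm1.Thm1At`) and instantiates for the pure small-field problem of the T³ family (`T3Thm1Carrier.varProblem3 F n K h`: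
configurations of run `K`, data of run `n`, print's two-clause regular fibre (6) `regFibrePr`, orbit relation `T3Thm1Carrier.SameOrbit` = print's group (4) `u↓ = 1`).
THIS FILE (def-free):
* §0 `AlphaInputsT3AC.uniqueMinOrbitRows_iff_unique6` — the two-token dictionary between the row-shaped letter `huniq` below and `B11Thm1.Unique6` at the carriers;
  `AlphaInputsT3AC.uniqueMinOrbitRows_of_atMostOneCriticalOrbit` — `huniq` ⟸ [7] PROP. 7's CLAUSE 1 («at most one critical orbit in (6)», `VarProblemX.AtMostOneCriticalOrbit`)
  at the carriers, the statement print proves in Sect. E; neither registry of record carries it (19200 `birth_v10`, 19936 `unbundled_v6`).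
* §1 ★★ `hcov_of_uniqueMinOrbit` — `hcov` at every level `k ≤ K` from the rows record `q`, the [Balaban1985Variational] data-smallness threshold
  `ha₁ : θBal ≤ q.a₁` (the letter of ✓`window_subset_chiMinAC_of_rows`), and ONE displayed binder `huniq` = THM 1's UNIQUENESS CLAUSE AT THE RECORD's CARRIERS AND
  CONSTANTS: row r1's quantifier prefix TOKEN FOR TOKEN (`∀ n < K, ∀ ε₁ ε₀, 0 < ε₁ → ε₁ ≤ q.a₁ → B₃ε₁ ≤ ε₀ → ε₀ ≤ q.a₀ → ∀ V, PlaqSmall ε₁ V →`, cf. `MinimiserRowsT3`∕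
  `TrivMinimiserRowsT3`), then print's sentence 2 in the tree's [7]-carrier vocabulary `∀ U, (varProblem3 F n K _).OnMinimalOrbit (B₃ε₁) V U → (varProblem3 F n K _).UniqueCriticalOrbit ε₀ V U`
  («`U` on a minimal orbit of (5) in (8) ⇒ every minimiser of (5) over (6)(ε₀) lies on the orbit of `U` under the group (4)», reading R2 of `T3Thm1Carrier` — the MINIMISER reading,
  implied by print's «critical» via Fermat on the open set (6), hence weaker than print: the safe direction).  Proof of §1 = print's own three lines for (181)
  ([Balaban1985Variational] p.307 «U_k(V^v) = U_k(V)^{v̄}»): shift the level-`k` datum to run `n = K − k` (`fieldShift`, ✓`fieldShift_gaugeAct`); row r1 at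
  `ε₁ := θBal(n)`, `ε₀ := B₃ε₁` puts `U_k(V)` and `U_k(V^u)` on minimal orbits of (8) over `V` and `V^u`; the LIFT `ũ` of `u` (✓`T3PrintedRegularOrbits.liftTransfTo`,
  `ũ↓ = u`) carries the first to a minimal orbit over `V^u` (✓`Prop7OrbitTransport.onMinimalOrbit_gaugeAct`: (6) is permuted, `A` is invariant); uniqueness of
  the minimal orbit over `V^u` gives `U_k(V^u) = (U_k(V)^{ũ})^{w}` with `w↓ = 1`, i.e. `= U_k(V)^{wũ}` (✓`gaugeAct_gaugeAct`).  `k = 0`: `U_0 = id` (✓`ukAll_zero_orbit`).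
* §1 `hloinv_loPrintAC_of_uniqueMinOrbit` — hence print's family `loPrintAC` is gauge invariant at every level (✓`hloinv_loPrintAC_of_orbit`).
* §2 ★ `fibre57LowOnAC_T3_loPrintAC_of_le_gamma_of_uniqueMinOrbit` = ✓`fibre57LowOnAC_T3_loPrintAC_of_le_gamma_of_orbit` VERBATIM except `hcov ↦ (ha₁, huniq)`.
Displayed after this edition at print's family: charts `Φ J T` (F2c), Gaussian datum, `hinv` (B0), the (55)∕(58) pins of `q.𝔖` at `triv` (B0 DEFINER), `hγs`, `ha₁`,
`huniq` (PRINTED: [7] Thm 1 sentence 2, in the tree's `T3Thm1Carrier`∕`B11Thm1` vocabulary), `hdom` (E2).  CURRENCIES: the primary currency of `huniq` is the T³ record's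
([7]'s pure small-field carrier `varProblem3`: `regFibrePr`, `descTransf`, print's asymmetric form «minimal in (8) ⇒ unique in (6)(ε₀)»); the N09 lineage's `huniq` of
✓`BalabanUVNodesN09AxialCovariance181.orbitRel_blockLift_of_uniqueOrbit` is the symmetric same-radius form over the LQB `B12` carrier (`IsBackground av reg`, `OrbitRel`) on ONE
tower — a different averaging object (no two-token bridge; the bridge is the carrier dictionary `fibre F ℰp n K` ↔ `Averaging.iter`, not attempted here).

HONEST SCOPE.  [folklore] bookkeeping of row r1 and of Thm 1's uniqueness clause; def-free; `huniq` is a HYPOTHESIS (a clause of a published theorem, typed as printed in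
`B11Thm1`, never asserted here); nothing of #23's pins, of `hdom`, of (47)∕(57), of the (α) data rows (0∕23), (O‴χₛ), `HistoryTailL` (19936), EX, LOWB∘ or `YM3TorusSU2`
is proved (rung R3 = SU(2) YM₃ on T³, a RECORD rung: NOT d = 4, NOT infinite volume, NOT a mass gap, NOT Clay; the Yang–Mills mass gap is NOT proved).  L-floor: none.
References: T. Bałaban, Commun. Math. Phys. **102** (1985) 255–275 [Balaban1985UV3] ((47) p.267, p.272 L32–33); **102** (1985) 277–309 [Balaban1985Variational]
((4)–(8) p.278, Thm 1 p.279, (181) p.307); **109** (1987) 249–301 [Balaban1987RG1] ((0.21) p.256, (2.3) p.265).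
-/

set_option autoImplicit false

noncomputable section

namespace Summit.QuantumFields.YangMills.Theorems

open MeasureTheory Literature.MathematicalPhysics.QuantumFieldTheory.Balaban1983to89
open Literature.MathematicalPhysics.QuantumFieldTheory.Balaban1983to89.GaugeField (GaugeInvariant gaugeAct)
open Literature.MathematicalPhysics.QuantumFieldTheory.Balaban1983to89.BlockAveraging (avgFun loopHol Idx)
open Literature.MathematicalPhysics.QuantumFieldTheory.Balaban1983to89.ExpMeanLog (expMeanLogSU)
open Literature.MathematicalPhysics.QuantumFieldTheory.Balaban1983to89.T3ContinuumYM3Torus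
open Literature.MathematicalPhysics.QuantumFieldTheory.Balaban1983to89.T3UnitScaleTilt (θBal)
open Literature.MathematicalPhysics.QuantumFieldTheory.Balaban1983to89.T3LevelShift (fieldShift siteShift)
open Literature.MathematicalPhysics.QuantumFieldTheory.Balaban1983to89.T3PrintedRegularMinimiser (regFibrePr)
open Literature.MathematicalPhysics.QuantumFieldTheory.Balaban1983to89.T3PrintedRegularOrbits (descTransf liftTransfTo descTransf_liftTransfTo)
open Literature.MathematicalPhysics.QuantumFieldTheory.Balaban1983to89.T3Thm1Carrier (varProblem3)
open Literature.MathematicalPhysics.QuantumFieldTheory.Balaban1983to89.T3UnitLawGaugeInvariance (gaugeAct_gaugeAct)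
open Literature.MathematicalPhysics.QuantumFieldTheory.Balaban1985CMP102 Literature.MathematicalPhysics.QuantumFieldTheory.Balaban1985CMP102.Setting
open Summit.QuantumFields.Balaban3D.Carriers
open Summit.QuantumFields.Balaban3D.Proofs.Primitives
open Summit.QuantumFields.Balaban3D.Proofs.Thresholds (Q0 Q0_pos)
open Summit.QuantumFields.Balaban3D.Proofs.TowerAC Summit.QuantumFields.Balaban3D.Proofs.StandardAC Summit.QuantumFields.Balaban3D.Proofs.InputsAC
open Summit.QuantumFields.Balaban3D.Proofs.Bound55Masses (chiB)
open Summit.QuantumFields.Balaban3D.Proofs.GaussianNormalization (partZ normalized)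
open Summit.QuantumFields.YangMills.Theorems.PinnedStep (Fibre57LowOnAC)
open scoped NNReal ENNReal

/-! ## §0 The displayed letter `huniq` and the tree's `B11Thm1.Unique6` at the T³ carriers (two-token dictionary) -/

/-- **DICTIONARY**: the row-shaped uniqueness letter `huniq` of this file (row r1's quantifier prefix, then print's sentence 2 at the carrier `varProblem3 F n K`:
«`U` on a minimal orbit of (5) in (8) over `V` ⇒ the orbit of `U` under the group (4) is the unique critical orbit in (6)(ε₀)», `B₃ε₁ ≤ ε₀ ≤ a₀`) IS `B11Thm1.Unique6` — [Balaban1985Variational]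
Thm 1's uniqueness clause typed as printed (the second conjunct of `B11Thm1.Thm1At`) — at the carriers `varProblem3 F n K`, `n < K`, with its `∀ ε₀` moved into r1's prefix position.
[cite: Balaban1985Variational, Thm 1 (8) p.279] -/
theorem AlphaInputsT3AC.uniqueMinOrbitRows_iff_unique6 (F : T3Family) (B₃ a₀ a₁ : ℝ) (K : ℕ) :
    (∀ (n : ℕ) (hnK : n < K) (ε₁ ε₀ : ℝ), 0 < ε₁ → ε₁ ≤ a₁ → B₃ * ε₁ ≤ ε₀ → ε₀ ≤ a₀ →
      ∀ V : GaugeField (F.P n) 0 (Matrix.specialUnitaryGroup (Fin 2) ℂ), PlaqSmall ε₁ V →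
        ∀ U : GaugeField (F.P K) 0 (Matrix.specialUnitaryGroup (Fin 2) ℂ),
          (varProblem3 F n K hnK.le).OnMinimalOrbit (B₃ * ε₁) V U → (varProblem3 F n K hnK.le).UniqueCriticalOrbit ε₀ V U) ↔
    (∀ (n : ℕ) (hnK : n < K) (ε₁ : ℝ), 0 < ε₁ → ε₁ ≤ a₁ →
      ∀ V : GaugeField (F.P n) 0 (Matrix.specialUnitaryGroup (Fin 2) ℂ), PlaqSmall ε₁ V →
        B11Thm1.Unique6 (varProblem3 F n K hnK.le).toVarProblem a₀ B₃ ε₁ V) :=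
  ⟨fun h n hnK ε₁ h₁ h₂ V hV ε₀ h₃ h₄ U hU => h n hnK ε₁ ε₀ h₁ h₂ h₃ h₄ V hV U hU,
    fun h n hnK ε₁ ε₀ h₁ h₂ h₃ h₄ V hV U hU => h n hnK ε₁ h₁ h₂ V hV ε₀ h₃ h₄ U hU⟩

/-- **THE LETTER `huniq` FROM [7] PROP. 7's CLAUSE 1 AT THE CARRIERS** («for ε₀ ≤ a₀ and B₃ε₁ ≤ ε₀ the variational problem (5), (6) has at most one critical orbit»,
`VarProblemX.AtMostOneCriticalOrbit` — the d = 3 reading of LQB's `B11.Prop7Printed` clause 1, the vocabulary of ✓`Prop7OrbitTransport.prop7From14_pureGaugeDatum`; `B₃ > 0`):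
a configuration on a minimal orbit of (8) = (6)(B₃ε₁) is critical in reading R2 (radius `B₃ε₁ > 0`) and lies in (6)(ε₀) ((8) ⊆ (6), ✓`regFibrePr_mono`); a minimiser over (6)(ε₀)
is critical in reading R2 (radius `ε₀`); clause 1 puts them on one orbit of the group (4).  So the r1′ letter is fed by Prop. 7's uniqueness clause, which neither registry of record
carries (19200 `birth_v10`: `stub_halvingStep`, `stub_existenceMinimalOrbit`; 19936 `unbundled_v6`: EX + (O‴χₛ)). [cite: Balaban1985Variational, Prop. 7 p.299 + Thm 1 (8) p.279] -/
theorem AlphaInputsT3AC.uniqueMinOrbitRows_of_atMostOneCriticalOrbit (F : T3Family) {B₃ : ℝ} (hB₃ : 0 < B₃) (a₀ a₁ : ℝ) (K : ℕ)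
    (h7 : ∀ (n : ℕ) (hnK : n < K) (ε₁ ε₀ : ℝ), 0 < ε₁ → ε₁ ≤ a₁ → B₃ * ε₁ ≤ ε₀ → ε₀ ≤ a₀ →
      ∀ V : GaugeField (F.P n) 0 (Matrix.specialUnitaryGroup (Fin 2) ℂ), PlaqSmall ε₁ V → (varProblem3 F n K hnK.le).AtMostOneCriticalOrbit ε₀ V) :
    ∀ (n : ℕ) (hnK : n < K) (ε₁ ε₀ : ℝ), 0 < ε₁ → ε₁ ≤ a₁ → B₃ * ε₁ ≤ ε₀ → ε₀ ≤ a₀ →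
      ∀ V : GaugeField (F.P n) 0 (Matrix.specialUnitaryGroup (Fin 2) ℂ), PlaqSmall ε₁ V →
        ∀ U : GaugeField (F.P K) 0 (Matrix.specialUnitaryGroup (Fin 2) ℂ),
          (varProblem3 F n K hnK.le).OnMinimalOrbit (B₃ * ε₁) V U → (varProblem3 F n K hnK.le).UniqueCriticalOrbit ε₀ V U := by
  intro n hnK ε₁ ε₀ h₁ h₂ h₃ h₄ V hV U hU
  obtain ⟨hU8, hmin8⟩ := hU
  have he : 0 < B₃ * ε₁ := mul_pos hB₃ h₁
  have hU6 : U ∈ regFibrePr F n K hnK.le ε₀ V := T3PrintedMinimiserExistence.regFibrePr_mono F h₃ V hU8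
  refine ⟨hU6, fun U' hU' hmin' => ?_⟩
  exact h7 n hnK ε₁ ε₀ h₁ h₂ h₃ h₄ V hV U U' ((T3PrintedRegularMinimiser.mem_regFibrePr_iff F).mp hU6).2
    ((T3PrintedRegularMinimiser.mem_regFibrePr_iff F).mp hU6).1 ⟨B₃ * ε₁, he, hU8, hmin8⟩
    ((T3PrintedRegularMinimiser.mem_regFibrePr_iff F).mp hU').2 ((T3PrintedRegularMinimiser.mem_regFibrePr_iff F).mp hU').1
    ⟨ε₀, he.trans_le h₃, hU', hmin'⟩

namespace AlphaInputsT3AC.PkgCoreRows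

variable {F : T3Family} {𝔠 : AlphaConsts F.L (suGroupModel 2).N} {γ : ℝ} {hγ : 0 < γ} {hγ1 : γ ≤ (min 𝔠.gamma0 1) ^ 2} {K : ℕ}
  (q : AlphaInputsT3AC.PkgCoreRows F 𝔠 γ hγ hγ1 K)

/-! ## §1 `hcov` from row r1 + Thm 1's uniqueness clause at the record's carriers -/

/-- Auxiliary form at the levels `K − n`, `n < K` (at least one averaging step): for `u` a gauge transformation of level `K − n` and `V` in the (4)-window
`|V(∂p) − 1| < ε₁(K−n) = θBal(n)`, the record's minimisers satisfy `U_{K−n}(V^u) = U_{K−n}(V)^w` for some `w` — row r1 (`q.minRows.1` at `ε₁ := θBal(n)`, `ε₀ := B₃ε₁`)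
at the data `V` and `V^u` (read on run `n`, ✓`fieldShift_gaugeAct`), transport of the first minimal orbit along the lift of `u` (✓`liftTransfTo`,
✓`Prop7OrbitTransport.onMinimalOrbit_gaugeAct`), and Thm 1's uniqueness clause `huniq` over `V^u`.
[cite: Balaban1985Variational, Thm 1 (8) p.279 + (181) p.307; Balaban1987RG1, (0.21) p.256] -/
theorem hcov_of_uniqueMinOrbit_aux (ha₁ : ∀ i, θBal F.L γ 𝔠.b₀ 𝔠.p₀ i ≤ q.a₁)
    (huniq : ∀ (n : ℕ) (hnK : n < K) (ε₁ ε₀ : ℝ), 0 < ε₁ → ε₁ ≤ q.a₁ → 𝔠.B₃ * ε₁ ≤ ε₀ → ε₀ ≤ q.a₀ →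
      ∀ V : GaugeField (F.P n) 0 (Matrix.specialUnitaryGroup (Fin 2) ℂ), PlaqSmall ε₁ V →
        ∀ U : GaugeField (F.P K) 0 (Matrix.specialUnitaryGroup (Fin 2) ℂ),
          (varProblem3 F n K hnK.le).OnMinimalOrbit (𝔠.B₃ * ε₁) V U → (varProblem3 F n K hnK.le).UniqueCriticalOrbit ε₀ V U)
    (n : ℕ) (hnK : n < K) :
    ∀ (u : GaugeTransf (F.P K) (K - n) (Matrix.specialUnitaryGroup (Fin 2) ℂ)) (V : GaugeField (F.P K) (K - n) (Matrix.specialUnitaryGroup (Fin 2) ℂ)),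
      PlaqSmall (eps1Of (T3Scales F γ hγ (hγ1.trans (sq_min_one_le _ 𝔠.gamma0_pos)) K) 𝔠.lane.carrier (K - n)) V →
        ∃ w : GaugeTransf (F.P K) 0 (Matrix.specialUnitaryGroup (Fin 2) ℂ), ukAll q.X.Uk (K - n) (gaugeAct u V) = gaugeAct w (ukAll q.X.Uk (K - n) V) := by
  intro u V hV
  -- thresholds: `ε₁(K−n) = θBal(n) ∈ (0, a₁]`, `B₃θBal(n) ≤ a₀`
  have hnn : K - (K - n) = n := Nat.sub_sub_self hnK.le
  have hθ : 0 < θBal F.L γ 𝔠.b₀ 𝔠.p₀ n := by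
    have := q.θBal_pos (K - n) (Nat.sub_le _ _); rwa [hnn] at this
  have heps : eps1Of (T3Scales F γ hγ (hγ1.trans (sq_min_one_le _ 𝔠.gamma0_pos)) K) 𝔠.lane.carrier (K - n) = θBal F.L γ 𝔠.b₀ 𝔠.p₀ n := by
    have := q.eps1_eq (K - n) (Nat.sub_le _ _); rwa [hnn] at this
  have hθa : θBal F.L γ 𝔠.b₀ 𝔠.p₀ n ≤ q.a₁ := ha₁ n
  have hhi : 𝔠.B₃ * θBal F.L γ 𝔠.b₀ 𝔠.p₀ n ≤ q.a₀ :=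
    (mul_le_mul_of_nonneg_left hθa 𝔠.B₃_pos.le).trans q.consts_ok.2.2
  have hε : 0 ≤ 𝔠.B₃ * θBal F.L γ 𝔠.b₀ 𝔠.p₀ n := (mul_pos 𝔠.B₃_pos hθ).le
  rw [heps] at hV
  -- shift the datum and the gauge transformation to height `n`, level `0` (opaque atoms `V₀`, `u₀`)
  have hsh : (F.PP F.m K).sitesPerDir (K - n) = (F.PP F.m n).sitesPerDir 0 :=
    F.sitesPerDir_eq (m := F.m) (K := K) (j := K - n) (m' := F.m) (K' := n) (j' := 0) (by omega)
  obtain ⟨V₀, hV₀def⟩ : ∃ V₀ : GaugeField (F.P n) 0 (Matrix.specialUnitaryGroup (Fin 2) ℂ), V₀ = fieldShift hsh.symm V := ⟨_, rfl⟩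
  obtain ⟨u₀, hu₀def⟩ : ∃ u₀ : GaugeTransf (F.P n) 0 (Matrix.specialUnitaryGroup (Fin 2) ℂ), u₀ = fun x => u (siteShift hsh.symm x) :=
    ⟨_, rfl⟩
  have hVK : fieldShift hsh V₀ = V := by
    rw [hV₀def]; exact T3LevelShift.fieldShift_symm_fieldShift hsh V
  have hUK : fieldShift hsh (gaugeAct u₀ V₀ : GaugeField (F.P n) 0 (Matrix.specialUnitaryGroup (Fin 2) ℂ)) =
      (gaugeAct u V : GaugeField (F.P K) (K - n) (Matrix.specialUnitaryGroup (Fin 2) ℂ)) := by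
    rw [hV₀def, hu₀def]
    exact ((congrArg (fieldShift hsh) (T3LevelShift.fieldShift_gaugeAct hsh.symm u V)).symm).trans
      (T3LevelShift.fieldShift_symm_fieldShift hsh _)
  have hV₀ : PlaqSmall (θBal F.L γ 𝔠.b₀ 𝔠.p₀ n) V₀ := by
    rw [hV₀def]; exact (T3CruxEstimates.plaqSmall_fieldShift F hsh.symm _ V).mpr hV
  have hV₀' : PlaqSmall (θBal F.L γ 𝔠.b₀ 𝔠.p₀ n) (gaugeAct u₀ V₀) :=
    (B12GaugeOrbits021.plaqSmall_gaugeAct_iff' _ u₀ V₀).mpr hV₀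
  -- row r1 at both data, `ε₁ := θBal(n)`, `ε₀ := B₃ε₁`
  have hr1 := q.minRows.1 n hnK (θBal F.L γ 𝔠.b₀ 𝔠.p₀ n) (𝔠.B₃ * θBal F.L γ 𝔠.b₀ 𝔠.p₀ n) hθ hθa le_rfl hhi V₀ hV₀
  rw [hVK] at hr1
  have hr1' := q.minRows.1 n hnK (θBal F.L γ 𝔠.b₀ 𝔠.p₀ n) (𝔠.B₃ * θBal F.L γ 𝔠.b₀ 𝔠.p₀ n) hθ hθa le_rfl hhi (gaugeAct u₀ V₀) hV₀'
  rw [hUK] at hr1'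
  -- transport the first minimal orbit along the lift of the coarse gauge transformation ((6) is permuted, `A` is invariant)
  have hlift := Prop7OrbitTransport.onMinimalOrbit_gaugeAct F hnK.le hε (liftTransfTo F n K hnK.le u₀) (V := V₀)
    (U := q.UkH (K - n) (Hist.triv (F.P K) (K - n)) V) hr1
  rw [descTransf_liftTransfTo] at hlift
  -- Thm 1's uniqueness clause over the datum `V₀^{u₀}`: both minimisers lie on ONE orbit of the group (4)
  obtain ⟨-, hU⟩ := huniq n hnK (θBal F.L γ 𝔠.b₀ 𝔠.p₀ n) (𝔠.B₃ * θBal F.L γ 𝔠.b₀ 𝔠.p₀ n) hθ hθa le_rfl hhi (gaugeAct u₀ V₀) hV₀' _ hlift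
  obtain ⟨w, -, hw⟩ := hU _ hr1'.1 hr1'.2
  refine ⟨fun x => w x * liftTransfTo F n K hnK.le u₀ x, ?_⟩
  rw [← q.X.UkH_triv (K - n) (gaugeAct u V), ← q.X.UkH_triv (K - n) V]
  exact hw.trans (gaugeAct_gaugeAct _ _ _)

/-- ★★ **THE ORBIT-COVARIANCE LETTER `hcov` OF THE LOWER ROW AT PRINT'S FAMILY, FROM ROW r1 AND [7] THM 1's UNIQUENESS CLAUSE**, every level `k ≤ K`: under the
[Balaban1985Variational] data-smallness threshold `θBal ≤ a₁` and the uniqueness clause `huniq` («the minimal orbit of (8) is the unique critical orbit in (6) for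
`B₃ε₁ ≤ ε₀ ≤ a₀`», `B11Thm1.Unique6` at the pure small-field carriers `T3Thm1Carrier.varProblem3 F n K`, `n < K`, and the record's constants `q.a₀`, `𝔠.B₃`), the record's
minimiser `U_k = ukAll q.X.Uk k` satisfies `U_k(V^u) ∈ orbit(U_k(V))` for every (4)-small `V` — ✓`…v3StepLowPrintOrbit`'s displayed `hcov` VERBATIM (`k = 0`: `U_0 = id`).
[cite: Balaban1985Variational, Thm 1 (8) p.279 + (181) p.307; Balaban1985UV3, (47) p.267; Balaban1987RG1, (0.21) p.256] -/
theorem hcov_of_uniqueMinOrbit (ha₁ : ∀ i, θBal F.L γ 𝔠.b₀ 𝔠.p₀ i ≤ q.a₁)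
    (huniq : ∀ (n : ℕ) (hnK : n < K) (ε₁ ε₀ : ℝ), 0 < ε₁ → ε₁ ≤ q.a₁ → 𝔠.B₃ * ε₁ ≤ ε₀ → ε₀ ≤ q.a₀ →
      ∀ V : GaugeField (F.P n) 0 (Matrix.specialUnitaryGroup (Fin 2) ℂ), PlaqSmall ε₁ V →
        ∀ U : GaugeField (F.P K) 0 (Matrix.specialUnitaryGroup (Fin 2) ℂ),
          (varProblem3 F n K hnK.le).OnMinimalOrbit (𝔠.B₃ * ε₁) V U → (varProblem3 F n K hnK.le).UniqueCriticalOrbit ε₀ V U)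
    (k : ℕ) (hk : k ≤ K) :
    ∀ (u : GaugeTransf (F.P K) k (Matrix.specialUnitaryGroup (Fin 2) ℂ)) (V : GaugeField (F.P K) k (Matrix.specialUnitaryGroup (Fin 2) ℂ)),
      PlaqSmall (eps1Of (T3Scales F γ hγ (hγ1.trans (sq_min_one_le _ 𝔠.gamma0_pos)) K) 𝔠.lane.carrier k) V →
        ∃ w : GaugeTransf (F.P K) 0 (Matrix.specialUnitaryGroup (Fin 2) ℂ), ukAll q.X.Uk k (gaugeAct u V) = gaugeAct w (ukAll q.X.Uk k V) := by
  rcases Nat.eq_zero_or_pos k with rfl | hk1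
  · exact fun u V _ => PinnedStep.ukAll_zero_orbit q.X.Uk u V
  · have h := q.hcov_of_uniqueMinOrbit_aux ha₁ huniq (K - k) (by omega)
    rwa [Nat.sub_sub_self hk] at h

/-- **`hloinv` AT PRINT'S FAMILY FROM ROW r1 + THM 1's UNIQUENESS CLAUSE**: print's family `loPrintAC 𝔠.lane q.X k` is gauge invariant at every level `k ≤ K`
(✓`hloinv_loPrintAC_of_orbit` ∘ §1). [cite: Balaban1985UV3, (47) p.267; Balaban1985Variational, Thm 1 (8) p.279] -/
theorem hloinv_loPrintAC_of_uniqueMinOrbit (ha₁ : ∀ i, θBal F.L γ 𝔠.b₀ 𝔠.p₀ i ≤ q.a₁)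
    (huniq : ∀ (n : ℕ) (hnK : n < K) (ε₁ ε₀ : ℝ), 0 < ε₁ → ε₁ ≤ q.a₁ → 𝔠.B₃ * ε₁ ≤ ε₀ → ε₀ ≤ q.a₀ →
      ∀ V : GaugeField (F.P n) 0 (Matrix.specialUnitaryGroup (Fin 2) ℂ), PlaqSmall ε₁ V →
        ∀ U : GaugeField (F.P K) 0 (Matrix.specialUnitaryGroup (Fin 2) ℂ),
          (varProblem3 F n K hnK.le).OnMinimalOrbit (𝔠.B₃ * ε₁) V U → (varProblem3 F n K hnK.le).UniqueCriticalOrbit ε₀ V U)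
    (k : ℕ) (hk : k ≤ K) :
    ∀ (u : GaugeTransf (F.P K) k (Matrix.specialUnitaryGroup (Fin 2) ℂ)) (U : GaugeField (F.P K) k (Matrix.specialUnitaryGroup (Fin 2) ℂ)),
      gaugeAct u U ∈ PinnedStep.loPrintAC 𝔠.lane q.X k ↔ U ∈ PinnedStep.loPrintAC 𝔠.lane q.X k :=
  q.hloinv_loPrintAC_of_orbit k (q.hcov_of_uniqueMinOrbit ha₁ huniq k hk)

/-! ## §2 The lower row at the T³ record on print's family, `hcov` discharged -/

/-- ★ **THE LOWER ROW AT THE T³ RECORD ON PRINT'S FAMILY, `hcov` DISCHARGED FROM ROW r1 + [7] THM 1's UNIQUENESS CLAUSE** —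
✓`fibre57LowOnAC_T3_loPrintAC_of_le_gamma_of_orbit` (✓`…v3StepLowPrintOrbit` §2) VERBATIM except `hcov ↦ (ha₁, huniq)`.  Displayed after this edition: charts,
Gaussian datum, `hinv`, the (55)∕(58) pins of `q.𝔖` at `triv`, `hγs`, `ha₁` ([7]'s data-smallness threshold), `huniq` ([7] Thm 1 sentence 2 as printed, `B11Thm1.Unique6` at
the carriers `varProblem3 F n K`), `hdom` (E2). [cite: Balaban1985UV3, (37) p.265 + (47) p.267 + (55)–(58) pp.269–270 + p.272 L32–33; Balaban1985Variational, Thm 1 (8) p.279] -/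
theorem fibre57LowOnAC_T3_loPrintAC_of_le_gamma_of_uniqueMinOrbit (hγs : γ ≤ ((((4500 : ℝ) * (F.L : ℝ) ^ 5)⁻¹ / (𝔠.b₀ * Q0 𝔠.p₀)) ^ 2) ^ 2)
    (ha₁ : ∀ i, θBal F.L γ 𝔠.b₀ 𝔠.p₀ i ≤ q.a₁)
    (huniq : ∀ (n : ℕ) (hnK : n < K) (ε₁ ε₀ : ℝ), 0 < ε₁ → ε₁ ≤ q.a₁ → 𝔠.B₃ * ε₁ ≤ ε₀ → ε₀ ≤ q.a₀ →
      ∀ V : GaugeField (F.P n) 0 (Matrix.specialUnitaryGroup (Fin 2) ℂ), PlaqSmall ε₁ V →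
        ∀ U : GaugeField (F.P K) 0 (Matrix.specialUnitaryGroup (Fin 2) ℂ),
          (varProblem3 F n K hnK.le).OnMinimalOrbit (𝔠.B₃ * ε₁) V U → (varProblem3 F n K hnK.le).UniqueCriticalOrbit ε₀ V U)
    (k : ℕ) (hk : k + 1 ≤ K)
    (Φ : GaugeField (F.P K) (k + 1) (Matrix.specialUnitaryGroup (Fin 2) ℂ) × GaugeField (F.P K) k (Matrix.specialUnitaryGroup (Fin 2) ℂ) →
      GaugeField (F.P K) k (Matrix.specialUnitaryGroup (Fin 2) ℂ))
    (J : GaugeField (F.P K) (k + 1) (Matrix.specialUnitaryGroup (Fin 2) ℂ) × GaugeField (F.P K) k (Matrix.specialUnitaryGroup (Fin 2) ℂ) → ℝ≥0)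
    (T : Set (GaugeField (F.P K) (k + 1) (Matrix.specialUnitaryGroup (Fin 2) ℂ) × GaugeField (F.P K) k (Matrix.specialUnitaryGroup (Fin 2) ℂ)))
    (hΦ : Measurable Φ) (hJ : Measurable J) (hT : MeasurableSet T)
    (hmap : ((((fieldMeasure (F.P K) (k + 1) (Matrix.specialUnitaryGroup (Fin 2) ℂ)).prod
        (fieldMeasure (F.P K) k (Matrix.specialUnitaryGroup (Fin 2) ℂ))).restrict T).withDensity (fun z => (J z : ℝ≥0∞))).map Φ =
      (fieldMeasure (F.P K) k (Matrix.specialUnitaryGroup (Fin 2) ℂ)).restrict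
        {U : GaugeField (F.P K) k (Matrix.specialUnitaryGroup (Fin 2) ℂ) |
          ∀ c i, dist1 (loopHol U c i) < ((Fintype.card (Idx (F.P K)) : ℝ))⁻¹ / 10})
    (hfib : ∀ z ∈ T, avgFun (expMeanLogSU (n := Fin 2)) (Φ z) = z.1) (N lσ dg : ℝ)
    (q_1 : GaugeField (F.P K) (k + 1) (Matrix.specialUnitaryGroup (Fin 2) ℂ) → GaugeField (F.P K) k (Matrix.specialUnitaryGroup (Fin 2) ℂ) → ℝ)
    (hqm : ∀ V, Measurable (q_1 V)) (hZ : ∀ V, 0 < partZ (fieldMeasure (F.P K) k (Matrix.specialUnitaryGroup (Fin 2) ℂ)) (q_1 V))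
    (hinv : GaugeInvariant (fun U : GaugeField (F.P K) k (Matrix.specialUnitaryGroup (Fin 2) ℂ) =>
      Real.exp (-((towerOfAC 𝔠.lane q.X q.𝔖).mainT k (Hist.triv (F.P K) k) U) + (towerOfAC 𝔠.lane q.X q.𝔖).Pint k (Hist.triv (F.P K) k) U)))
    (hdom : ∀ U : GaugeField (F.P K) k (Matrix.specialUnitaryGroup (Fin 2) ℂ),
      chiB 𝔠.lane.carrier.M₁ (rcolOf (T3Scales F γ hγ (hγ1.trans (sq_min_one_le _ 𝔠.gamma0_pos)) K) 𝔠.lane.carrier) (eps1Of (T3Scales F γ hγ (hγ1.trans (sq_min_one_le _ 𝔠.gamma0_pos)) K) 𝔠.lane.carrier) k (Hist.triv (F.P K) (k + 1)) U ≠ 0 → U ∈ PinnedStep.loPrintAC 𝔠.lane q.X k)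
    (hσ : (piecesAC 𝔠.lane q.X q.𝔖 k).logσ₀ = lσ) (hdg : (piecesAC 𝔠.lane q.X q.𝔖 k).dg = dg)
    (hstar : (piecesAC 𝔠.lane q.X q.𝔖 k).starB (Hist.triv (F.P K) (k + 1)) = N)
    (hZU : ∀ V, (piecesAC 𝔠.lane q.X q.𝔖 k).logZU (Hist.triv (F.P K) (k + 1)) V =
      Real.log (partZ (fieldMeasure (F.P K) k (Matrix.specialUnitaryGroup (Fin 2) ℂ)) (q_1 V)))
    (hFl : ∀ V, (piecesAC 𝔠.lane q.X q.𝔖 k).logFl (Hist.triv (F.P K) (k + 1)) V =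
      Real.log (∫ U', (Real.exp (-((lσ + dg * Real.log ((T3Scales F γ hγ (hγ1.trans (sq_min_one_le _ 𝔠.gamma0_pos)) K).gk k)) * N)) * T.indicator (fun z => (J z : ℝ)) (V, U')) *
              chiB 𝔠.lane.carrier.M₁ (rcolOf (T3Scales F γ hγ (hγ1.trans (sq_min_one_le _ 𝔠.gamma0_pos)) K) 𝔠.lane.carrier) (eps1Of (T3Scales F γ hγ (hγ1.trans (sq_min_one_le _ 𝔠.gamma0_pos)) K) 𝔠.lane.carrier) k
                (Hist.triv (F.P K) (k + 1)) (Φ (V, U')) *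
              Real.exp (-((towerOfAC 𝔠.lane q.X q.𝔖).mainT k (Hist.triv (F.P K) k) (Φ (V, U')) -
                    (towerOfAC 𝔠.lane q.X q.𝔖).mainT (k + 1) (Hist.triv (F.P K) (k + 1)) V)
                + ((towerOfAC 𝔠.lane q.X q.𝔖).Pint k (Hist.triv (F.P K) k) (Φ (V, U')) - (piecesAC 𝔠.lane q.X q.𝔖 k).Pold (Hist.triv (F.P K) (k + 1)) V)
                + q_1 V U')
            ∂(normalized (fieldMeasure (F.P K) k (Matrix.specialUnitaryGroup (Fin 2) ℂ)) (q_1 V)))) :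
    Fibre57LowOnAC 𝔠.lane q.X q.𝔖 (PinnedStep.loPrintAC 𝔠.lane q.X) k :=
  q.fibre57LowOnAC_T3_loPrintAC_of_le_gamma_of_orbit hγs k hk (q.hcov_of_uniqueMinOrbit ha₁ huniq k (by omega)) Φ J T hΦ hJ hT hmap hfib N lσ dg
    q_1 hqm hZ hinv hdom hσ hdg hstar hZU hFl

end AlphaInputsT3AC.PkgCoreRows

end Summit.QuantumFields.YangMills.Theorems

end
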